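import Mathlib.Analysis.Calculus.InverseFunctionTheorem.FDeriv
import Mathlib.Analysis.Calculus.ContDiff.Operations
import Mathlib.Analysis.Calculus.ContDiff.RCLike
import Mathlib.Analysis.Calculus.Deriv.MeanValue
import Mathlib.Analysis.Calculus.Deriv.Prod
import Mathlib.Topology.Order.IntermediateValue
import HarnessLib

/-!
# Global inversion of a fibred map `(t, x) ↦ (Λ (t, x), x)` with `∂ₜ Λ` bounded below

Topic `Literature/Analysis/Calculus`.  A `C^∞` function `Λ : ℝ × F → ℝ` whose derivative in the
first variable is bounded below by a positive constant (`∂ₜ Λ ≥ 1/2`) is, for each `x`, a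
strictly increasing bijection of `ℝ`; the fibred map `G (t, x) = (Λ (t, x), x)` is then a `C^∞`
bijection of `ℝ × F` with invertible derivative everywhere, hence (inverse function theorem,
Mathlib's `Homeomorph.contDiff_symm` for a continuous open bijection,
`isOpenMap_of_hasStrictFDerivAt_equiv`) a `C^∞` diffeomorphism, and its inverse has the form
`(s, x) ↦ (τ (s, x), x)` with `τ` `C^∞` (`exists_contDiff_fibredInverse`).  If `Λ` is
equivariant under an integer translation, so is `τ` (`fibredInverse_add`).

This elementary global form of the inverse function theorem "with parameters" is the analytic
step that straightens the pages of a fibration along an embedded circle (tree: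
`Literature/Topology/FourManifolds`, tubes along the round locus of a broken Lefschetz
fibration).  Everything here is **proved**; no definition, no named fact.

## References

* J. Dieudonné, *Foundations of Modern Analysis*, Academic Press (1960), Ch. X §2, (10.2.5)
  (inverse function theorem) and (10.2.3) (dependence on parameters). [Dieudonne1960]
-/

noncomputable section

open Set Function Filter Topology
open scoped ContDiff

namespace Literature.Analysis.Calculus

variable {F : Type*} [NormedAddCommGroup F] [NormedSpace ℝ F] [CompleteSpace F]

/-- **Global fibred inversion.**  Let `Λ : ℝ × F → ℝ` be `C^∞` with `∂ₜ Λ (t, x) ≥ 1/2` for all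
`(t, x)` (`∂ₜ = fderiv · (1, 0)`).  Then there is a `C^∞` function `τ : ℝ × F → ℝ` with
`Λ (τ (s, x), x) = s` and `τ (Λ (t, x), x) = t`: for each `x`, `τ (·, x)` is the inverse of the
increasing bijection `Λ (·, x)`, and `(s, x) ↦ (τ (s, x), x)` is the `C^∞` inverse of the
diffeomorphism `(t, x) ↦ (Λ (t, x), x)` of `ℝ × F`. [cite: Dieudonne1960, Ch. X §2, (10.2.5)] -/
theorem exists_contDiff_fibredInverse {Λ : ℝ × F → ℝ} (hΛ : ContDiff ℝ ∞ Λ)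
    (hder : ∀ q : ℝ × F, (1 / 2 : ℝ) ≤ fderiv ℝ Λ q (1, 0)) :
    ∃ τ : ℝ × F → ℝ, ContDiff ℝ ∞ τ ∧ (∀ (s : ℝ) (x : F), Λ (τ (s, x), x) = s) ∧
      ∀ (t : ℝ) (x : F), τ (Λ (t, x), x) = t := by
  have hdiffΛ : Differentiable ℝ Λ := hΛ.differentiable (by simp)
  -- the slices `t ↦ Λ (t, x)`
  have hslice : ∀ (x : F) (t : ℝ),
      HasDerivAt (fun t : ℝ => Λ (t, x)) (fderiv ℝ Λ (t, x) (1, 0)) t := fun x t =>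
    (hdiffΛ (t, x)).hasFDerivAt.comp_hasDerivAt t
      ((hasDerivAt_id t).prodMk (hasDerivAt_const t x))
  have hderiv : ∀ (x : F) (t : ℝ), deriv (fun t : ℝ => Λ (t, x)) t = fderiv ℝ Λ (t, x) (1, 0) :=
    fun x t => (hslice x t).deriv
  have hdiff : ∀ x : F, Differentiable ℝ fun t : ℝ => Λ (t, x) := fun x t =>
    (hslice x t).differentiableAt
  have hmono : ∀ x : F, StrictMono fun t : ℝ => Λ (t, x) := fun x =>
    strictMono_of_deriv_pos fun t => by rw [hderiv]; linarith [hder (t, x)]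
  have hgrow : ∀ (x : F) (t t' : ℝ), t ≤ t' → 1 / 2 * (t' - t) ≤ Λ (t', x) - Λ (t, x) :=
    fun x t t' h =>
      mul_sub_le_image_sub_of_le_deriv (hdiff x) (fun t => by rw [hderiv]; exact hder (t, x)) h
  have hsurj : ∀ x : F, Surjective fun t : ℝ => Λ (t, x) := fun x => by
    refine (hdiff x).continuous.surjective ?_ ?_
    · have h : Tendsto (fun t : ℝ => Λ (0, x) + 1 / 2 * t) atTop atTop :=
        tendsto_atTop_add_const_left _ _ (Tendsto.const_mul_atTop (by norm_num) tendsto_id)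
      refine tendsto_atTop_mono' atTop ?_ h
      filter_upwards [eventually_ge_atTop 0] with t ht
      have := hgrow x 0 t ht
      linarith
    · have h : Tendsto (fun t : ℝ => Λ (0, x) + 1 / 2 * t) atBot atBot :=
        tendsto_atBot_add_const_left _ _ (Tendsto.const_mul_atBot (by norm_num) tendsto_id)
      refine tendsto_atBot_mono' atBot ?_ h
      filter_upwards [eventually_le_atBot 0] with t ht
      have := hgrow x t 0 ht
      linarith
  -- the fibred map `G` is a continuous bijection
  have hbij : Bijective fun q : ℝ × F => (Λ q, q.2) := by
    refine ⟨?_, fun p => ?_⟩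
    · rintro ⟨a, x⟩ ⟨a', x'⟩ h
      obtain ⟨h1, h2⟩ := Prod.mk.inj h
      dsimp only at h2
      subst h2
      exact Prod.ext ((hmono x).injective h1) rfl
    · obtain ⟨t, ht⟩ := hsurj p.2 p.1
      exact ⟨(t, p.2), Prod.ext ht rfl⟩
  have hGs : ContDiff ℝ ∞ fun q : ℝ × F => (Λ q, q.2) := hΛ.prodMk contDiff_snd
  -- its derivative is an equivalence
  have hd : ∀ q : ℝ × F, fderiv ℝ Λ q (1, 0) ≠ 0 := fun q => by linarith [hder q]
  have hsplit : ∀ (q : ℝ × F) (a : ℝ) (v : F),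
      fderiv ℝ Λ q (a, v) = a * fderiv ℝ Λ q (1, 0) + fderiv ℝ Λ q (0, v) := fun q a v => by
    have h : ((a, v) : ℝ × F) = a • ((1 : ℝ), (0 : F)) + ((0 : ℝ), v) := by
      rw [Prod.smul_mk, Prod.mk_add_mk, smul_zero, zero_add, smul_eq_mul, mul_one, add_zero]
    rw [h, map_add, map_smul, smul_eq_mul]
  obtain ⟨L, hL⟩ : ∃ L : ℝ × F → ((ℝ × F) ≃L[ℝ] (ℝ × F)), ∀ q,
      (L q : (ℝ × F) →L[ℝ] (ℝ × F)) = (fderiv ℝ Λ q).prod (ContinuousLinearMap.snd ℝ ℝ F) := by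
    refine ⟨fun q => ContinuousLinearEquiv.equivOfInverse
      ((fderiv ℝ Λ q).prod (ContinuousLinearMap.snd ℝ ℝ F))
      (((fderiv ℝ Λ q (1, 0))⁻¹ • (ContinuousLinearMap.fst ℝ ℝ F -
        (fderiv ℝ Λ q).comp ((ContinuousLinearMap.inr ℝ ℝ F).comp
          (ContinuousLinearMap.snd ℝ ℝ F)))).prod (ContinuousLinearMap.snd ℝ ℝ F))
      (fun p => ?_) (fun p => ?_), fun q => rfl⟩
    · obtain ⟨a, v⟩ := p
      refine Prod.ext ?_ rfl
      simp only [ContinuousLinearMap.prod_apply, ContinuousLinearMap.coe_snd',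
        smul_apply, sub_apply,
        ContinuousLinearMap.coe_fst', ContinuousLinearMap.comp_apply,
        ContinuousLinearMap.inr_apply, smul_eq_mul, hsplit q a v]
      field_simp [hd q]
      ring
    · obtain ⟨b, v⟩ := p
      refine Prod.ext ?_ rfl
      simp only [ContinuousLinearMap.prod_apply, ContinuousLinearMap.coe_snd',
        smul_apply, sub_apply,
        ContinuousLinearMap.coe_fst', ContinuousLinearMap.comp_apply,
        ContinuousLinearMap.inr_apply, smul_eq_mul]
      rw [hsplit q]
      field_simp [hd q]
      ring
  have hstrict : ∀ q : ℝ × F,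
      HasStrictFDerivAt (fun q : ℝ × F => (Λ q, q.2)) (L q : (ℝ × F) →L[ℝ] (ℝ × F)) q :=
    fun q => by
      rw [hL]
      exact (hΛ.hasStrictFDerivAt (by simp)).prodMk hasStrictFDerivAt_snd
  have hopen : IsOpenMap fun q : ℝ × F => (Λ q, q.2) := isOpenMap_of_hasStrictFDerivAt_equiv hstrict
  -- the inverse homeomorphism is smooth
  set H : (ℝ × F) ≃ₜ (ℝ × F) :=
    (Equiv.ofBijective _ hbij).toHomeomorphOfContinuousOpen hGs.continuous hopen with hH
  have hHapply : ∀ q : ℝ × F, H q = (Λ q, q.2) := fun q => rfl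
  have hsymm : ContDiff ℝ ∞ (H.symm : ℝ × F → ℝ × F) :=
    H.contDiff_symm (fun q => (hstrict q).hasFDerivAt) hGs
  have hright : ∀ p : ℝ × F, (Λ (H.symm p), (H.symm p).2) = p := fun p => by
    rw [← hHapply, H.apply_symm_apply]
  refine ⟨fun p => (H.symm p).1, contDiff_fst.comp hsymm, fun s x => ?_, fun t x => ?_⟩
  · have h := hright (s, x)
    obtain ⟨h1, h2⟩ := Prod.mk.inj h
    have h3 : ((H.symm (s, x)).1, x) = H.symm (s, x) := Prod.ext rfl h2.symm
    show Λ ((H.symm (s, x)).1, x) = s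
    rw [h3]
    exact h1
  · show (H.symm (Λ (t, x), x)).1 = t
    rw [show ((Λ (t, x), x) : ℝ × F) = H (t, x) from rfl, H.symm_apply_apply]

omit [NormedAddCommGroup F] [NormedSpace ℝ F] [CompleteSpace F] in
/-- **Equivariance of the fibred inverse.**  If `τ (·, x)` inverts `Λ (·, x)` for every `x` and
`Λ (t + T, x) = Λ (t, x) + T`, then `τ (s + T, x) = τ (s, x) + T`. [folklore] -/
theorem fibredInverse_add {Λ τ : ℝ × F → ℝ} {T : ℝ}
    (h₁ : ∀ (s : ℝ) (x : F), Λ (τ (s, x), x) = s) (h₂ : ∀ (t : ℝ) (x : F), τ (Λ (t, x), x) = t)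
    (hΛ : ∀ (t : ℝ) (x : F), Λ (t + T, x) = Λ (t, x) + T) (s : ℝ) (x : F) :
    τ (s + T, x) = τ (s, x) + T := by
  have h : Λ (τ (s, x) + T, x) = s + T := by rw [hΛ, h₁]
  rw [← h, h₂]

end Literature.Analysis.Calculus
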